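import Summits.AtomisticToContinuum.Crystallization.Theorems.SquareWellLayerCakeStackingFaultSparsityOffBoxDefs

/-!
# `StackingFaultSparsity` (stmt-AtomisticToContinuum-14296), line `Sketch`: stub `stub_offBoxFarLayers`

Far-layer tails of the certified off-box scale gap.  Given the per-layer certification of the
layer sums `layerSum e c k` (summability, the two-sided square truncation with the in-plane shell
tail `layerTail`, antitonicity in the height — this is the hypothesis, proved separately as the
stub `stub_offBoxLayerCert`), every far layer `k > K` of the registry-shifted (`layerSum e (k c) 1`)
and of the aligned (`layerSum e (k c / 2) 2`) family at height `t = k c` is bounded by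
`49 t^{-2e} + 128/(19(e-1)) · t^{-2(e-1)}`: the `7 × 7` square `layerSquare 3` contributes `49`
terms `≤ t^{-2e}` (`hcpSumQ ≥ 0`), and `layerTail e 3 t ≤ 128/(19(e-1)) · t^{-2(e-1)}`.  Summing
over `k ∈ (K, K + n]` with the telescoping estimate `∑_{k > K} k^{-(m+1)} ≤ 1/(m K^m)` gives
`farTail3 K c = 49/(5K⁵c⁶) + 64/(57K³c⁴)` (`e = 3`) and `farTail6 K c = 49/(11K¹¹c¹²) + 128/(855K⁹c¹⁰)`
(`e = 6`).  All statements are [folklore] numerics bookkeeping.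
-/

noncomputable section

namespace Summit.AtomisticToContinuum.Crystallization.Theorems.SquareWellLayerCake.StackingFaultSparsity

open Summit.AtomisticToContinuum.Crystallization.Theorems.ExcessDecayLiouvilleCoarseGrains

/-! ## Telescoping tail of `∑ k^{-(m+1)}` -/

/-- Bernoulli-type step `k^m (k + m + 1) ≤ (k + 1)^{m+1}` for `k ≥ 0`. [folklore] -/
private theorem farLayers_pow_mul_le {k : ℝ} (hk : 0 ≤ k) (m : ℕ) :
    k ^ m * (k + m + 1) ≤ (k + 1) ^ (m + 1) := by
  induction m with
  | zero => simp
  | succ m ih =>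
    have hkm : 0 ≤ k ^ m := pow_nonneg hk m
    have hm0 : (0 : ℝ) ≤ m := m.cast_nonneg
    calc k ^ (m + 1) * (k + ((m + 1 : ℕ) : ℝ) + 1)
        = k ^ (m + 1) * (k + m + 1) + k ^ m * k := by push_cast; ring
      _ ≤ k ^ (m + 1) * (k + m + 1) + k ^ m * (k + m + 1) := by
          have : k ^ m * k ≤ k ^ m * (k + m + 1) :=
            mul_le_mul_of_nonneg_left (by linarith) hkm
          linarith
      _ = (k + 1) * (k ^ m * (k + m + 1)) := by ring
      _ ≤ (k + 1) * (k + 1) ^ (m + 1) := mul_le_mul_of_nonneg_left ih (by linarith)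
      _ = (k + 1) ^ (m + 1 + 1) := by ring

/-- Telescoping step `m (k+1)^{-(m+1)} ≤ k^{-m} - (k+1)^{-m}` for `k > 0`. [folklore] -/
private theorem farLayers_inv_pow_step {k : ℝ} (hk : 0 < k) (m : ℕ) :
    (m : ℝ) * ((k + 1) ^ (m + 1))⁻¹ ≤ (k ^ m)⁻¹ - ((k + 1) ^ m)⁻¹ := by
  have hkm : 0 < k ^ m := pow_pos hk m
  have hk1 : 0 < (k + 1) ^ m := pow_pos (by linarith) m
  have hk0 : 0 < k + 1 := by linarith
  have key := farLayers_pow_mul_le hk.le m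
  rw [pow_succ] at key ⊢
  rw [inv_eq_one_div, inv_eq_one_div, inv_eq_one_div, div_sub_div _ _ hkm.ne' hk1.ne',
    mul_one_div, div_le_div_iff₀ (mul_pos hk1 hk0) (mul_pos hkm hk1)]
  nlinarith [mul_nonneg hk1.le (sub_nonneg.2 key)]

/-- **Tail of `∑ k^{-(m+1)}`**: `∑_{k=K+1}^{K+n} k^{-(m+1)} ≤ 1/(m K^m)` for `K, m ≥ 1`. [folklore] -/
private theorem farLayers_sum_inv_pow_le {K m : ℕ} (hK : 1 ≤ K) (hm : 1 ≤ m) (n : ℕ) :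
    ∑ k ∈ Finset.Ioc K (K + n), ((k : ℝ) ^ (m + 1))⁻¹ ≤ 1 / ((m : ℝ) * (K : ℝ) ^ m) := by
  have hK0 : (0 : ℝ) < K := by exact_mod_cast hK
  have hm0 : (0 : ℝ) < m := by exact_mod_cast hm
  have htel : ∀ n : ℕ, ∑ k ∈ Finset.Ioc K (K + n), ((k : ℝ) ^ (m + 1))⁻¹ ≤
      1 / (m : ℝ) * (((K : ℝ) ^ m)⁻¹ - (((K + n : ℕ) : ℝ) ^ m)⁻¹) := by
    intro n
    induction n with
    | zero => simp
    | succ n ih =>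
      rw [← add_assoc, Finset.sum_Ioc_succ_top (by omega), Nat.cast_succ]
      have hKn : (0 : ℝ) < ((K + n : ℕ) : ℝ) := by push_cast; linarith [(n.cast_nonneg : (0 : ℝ) ≤ n)]
      have hstep := farLayers_inv_pow_step hKn m
      have hstep' : ((((K + n : ℕ) : ℝ) + 1) ^ (m + 1))⁻¹ ≤
          1 / (m : ℝ) * ((((K + n : ℕ) : ℝ) ^ m)⁻¹ - ((((K + n : ℕ) : ℝ) + 1) ^ m)⁻¹) := by
        rw [one_div, ← div_eq_inv_mul, le_div_iff₀ hm0, mul_comm]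
        exact hstep
      have hsplit : 1 / (m : ℝ) * (((K : ℝ) ^ m)⁻¹ - ((((K + n : ℕ) : ℝ) + 1) ^ m)⁻¹) =
          1 / (m : ℝ) * (((K : ℝ) ^ m)⁻¹ - (((K + n : ℕ) : ℝ) ^ m)⁻¹) +
            1 / (m : ℝ) * ((((K + n : ℕ) : ℝ) ^ m)⁻¹ - ((((K + n : ℕ) : ℝ) + 1) ^ m)⁻¹) := by ring
      rw [hsplit]
      exact add_le_add ih hstep'
  have hn : 0 ≤ (((K + n : ℕ) : ℝ) ^ m)⁻¹ := by positivity
  calc ∑ k ∈ Finset.Ioc K (K + n), ((k : ℝ) ^ (m + 1))⁻¹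
      ≤ 1 / (m : ℝ) * (((K : ℝ) ^ m)⁻¹ - (((K + n : ℕ) : ℝ) ^ m)⁻¹) := htel n
    _ ≤ 1 / (m : ℝ) * ((K : ℝ) ^ m)⁻¹ :=
        mul_le_mul_of_nonneg_left (by linarith) (by positivity)
    _ = 1 / ((m : ℝ) * (K : ℝ) ^ m) := by rw [one_div, one_div, ← mul_inv]

/-! ## One far layer -/

/-- One term of a far layer: `hcpSumTerm e c (k, i, j) ≤ t^{-2e}` when `k c = t > 0` (`hcpSumQ ≥ 0`).
[folklore] -/
private theorem farLayers_term_le (e : ℕ) {c t : ℝ} (ht : 0 < t) {k : ℤ} (hkc : (k : ℝ) * c = t)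
    (i j : ℤ) : hcpSumTerm e c (k, i, j) ≤ ((t ^ 2)⁻¹) ^ e := by
  unfold hcpSumTerm
  split_ifs
  · positivity
  · have hQ := hcpSumQ_nonneg (k, i, j)
    have hle : t ^ 2 ≤ hcpSumQ (k, i, j) + ((k, i, j).1 : ℝ) ^ 2 * c ^ 2 := by
      show t ^ 2 ≤ hcpSumQ (k, i, j) + (k : ℝ) ^ 2 * c ^ 2
      rw [← hkc]
      nlinarith [hQ]
    exact pow_le_pow_left₀ (inv_nonneg.2 (by positivity)) (inv_anti₀ (by positivity) hle) e

/-- The in-plane square `layerSquare 3` has `49` sites. [folklore] -/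
private theorem farLayers_card_layerSquare_three : ((layerSquare 3).card : ℝ) = 49 := by
  have h : (layerSquare 3).card = 49 := by
    simp only [layerSquare, Finset.card_product, Int.card_Icc]
    rfl
  rw [h]
  norm_num

/-- **A far layer** from its `K = 3` certification: if `k c = t > 0` then
`layerSum (d+1) c k ≤ 49 t^{-2(d+1)} + 128/(19 d) · t^{-2d}` (`49` square terms `≤ t^{-2(d+1)}`,
`layerTail (d+1) 3 t = 128/(19 d) (16/3 + t²)^{-d} ≤ 128/(19 d) t^{-2d}`). [folklore] -/
private theorem farLayers_layer_le {d : ℕ} {c t : ℝ} (ht : 0 < t) {k : ℤ} (hkc : (k : ℝ) * c = t)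
    (hup : layerSum (d + 1) c k ≤
      ∑ ij ∈ layerSquare 3, hcpSumTerm (d + 1) c (k, ij.1, ij.2) + layerTail (d + 1) 3 ((k : ℝ) * c)) :
    layerSum (d + 1) c k ≤ 49 * ((t ^ 2)⁻¹) ^ (d + 1) + 128 / (19 * (d : ℝ)) * ((t ^ 2)⁻¹) ^ d := by
  have hsq : ∑ ij ∈ layerSquare 3, hcpSumTerm (d + 1) c (k, ij.1, ij.2) ≤ 49 * ((t ^ 2)⁻¹) ^ (d + 1) := by
    calc ∑ ij ∈ layerSquare 3, hcpSumTerm (d + 1) c (k, ij.1, ij.2)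
        ≤ ∑ ij ∈ layerSquare 3, ((t ^ 2)⁻¹) ^ (d + 1) :=
          Finset.sum_le_sum fun ij _ => farLayers_term_le (d + 1) ht hkc ij.1 ij.2
      _ = 49 * ((t ^ 2)⁻¹) ^ (d + 1) := by
          rw [Finset.sum_const, nsmul_eq_mul, farLayers_card_layerSquare_three]
  have hX : ((3 / 4 * (((3 : ℕ) : ℝ) - 1 / 3) ^ 2 + t ^ 2)⁻¹) ^ (d + 1 - 1) ≤ ((t ^ 2)⁻¹) ^ d := by
    rw [Nat.add_sub_cancel]
    have h0 : 0 ≤ 3 / 4 * (((3 : ℕ) : ℝ) - 1 / 3) ^ 2 := by positivity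
    exact pow_le_pow_left₀ (inv_nonneg.2 (by positivity))
      (inv_anti₀ (by positivity) (by linarith)) d
  have hC : 32 * (((3 : ℕ) : ℝ) + 1) / ((((d + 1 : ℕ) : ℝ) - 1) * (6 * ((3 : ℕ) : ℝ) + 1)) =
      128 / (19 * (d : ℝ)) := by
    push_cast
    ring
  have htail : layerTail (d + 1) 3 ((k : ℝ) * c) ≤ 128 / (19 * (d : ℝ)) * ((t ^ 2)⁻¹) ^ d := by
    rw [hkc]
    calc layerTail (d + 1) 3 t
        = 32 * (((3 : ℕ) : ℝ) + 1) / ((((d + 1 : ℕ) : ℝ) - 1) * (6 * ((3 : ℕ) : ℝ) + 1)) *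
            ((3 / 4 * (((3 : ℕ) : ℝ) - 1 / 3) ^ 2 + t ^ 2)⁻¹) ^ (d + 1 - 1) := rfl
      _ ≤ 128 / (19 * (d : ℝ)) * ((t ^ 2)⁻¹) ^ d := by
          rw [hC]
          exact mul_le_mul_of_nonneg_left hX (by positivity)
  linarith [hup, hsq, htail]

/-! ## The stub -/

/-- **Far layers of the off-box certificate** (stub `stub_offBoxFarLayers` of line `Sketch`): given the
per-layer certification of the layer sums (the hypothesis), for `c > 0`, `K ≥ 1` and every `n`,
`∑_{k=K+1}^{K+n} layerSum 3 (k c) 1 ≤ farTail3 K c`, `∑_{k=K+1}^{K+n} layerSum 3 (k c/2) 2 ≤ farTail3 K c`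
and `∑_{k=K+1}^{K+n} layerSum 6 (k c/2) 2 ≤ farTail6 K c`. [folklore] -/
theorem stub_offBoxFarLayers :
    (∀ (e : ℕ), 3 ≤ e → ∀ (c : ℝ), 0 < c → ∀ (k : ℤ),
      Summable (fun ij : ℤ × ℤ => hcpSumTerm e c (k, ij.1, ij.2)) ∧
      (∀ K : ℕ, 1 ≤ K →
        ∑ ij ∈ layerSquare K, hcpSumTerm e c (k, ij.1, ij.2) ≤ layerSum e c k ∧
        layerSum e c k ≤ ∑ ij ∈ layerSquare K, hcpSumTerm e c (k, ij.1, ij.2) + layerTail e K ((k : ℝ) * c)) ∧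
      (∀ c' : ℝ, c ≤ c' → layerSum e c' k ≤ layerSum e c k)) →
    ∀ (c : ℝ), 0 < c → ∀ (K : ℕ), 1 ≤ K → ∀ n : ℕ,
      ∑ k ∈ Finset.Ioc K (K + n), layerSum 3 ((k : ℝ) * c) 1 ≤ farTail3 K c ∧
      ∑ k ∈ Finset.Ioc K (K + n), layerSum 3 ((k : ℝ) * c / 2) 2 ≤ farTail3 K c ∧
      ∑ k ∈ Finset.Ioc K (K + n), layerSum 6 ((k : ℝ) * c / 2) 2 ≤ farTail6 K c := by
  intro H c hc K hK n
  -- pointwise far-layer bounds (`t = k c`, `k ≥ 1`)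
  have hpt : ∀ k : ℕ, 1 ≤ k →
      layerSum 3 ((k : ℝ) * c) 1 ≤ 49 / c ^ 6 * ((k : ℝ) ^ 6)⁻¹ + 64 / (19 * c ^ 4) * ((k : ℝ) ^ 4)⁻¹ ∧
      layerSum 3 ((k : ℝ) * c / 2) 2 ≤
        49 / c ^ 6 * ((k : ℝ) ^ 6)⁻¹ + 64 / (19 * c ^ 4) * ((k : ℝ) ^ 4)⁻¹ ∧
      layerSum 6 ((k : ℝ) * c / 2) 2 ≤
        49 / c ^ 12 * ((k : ℝ) ^ 12)⁻¹ + 128 / (95 * c ^ 10) * ((k : ℝ) ^ 10)⁻¹ := by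
    intro k hk
    have hk0 : (0 : ℝ) < k := by exact_mod_cast hk
    have ht : 0 < (k : ℝ) * c := mul_pos hk0 hc
    have ht2 : 0 < (k : ℝ) * c / 2 := by positivity
    have e1 : ((1 : ℤ) : ℝ) * ((k : ℝ) * c) = (k : ℝ) * c := by simp
    have e2 : ((2 : ℤ) : ℝ) * ((k : ℝ) * c / 2) = (k : ℝ) * c := by push_cast; ring
    have b1 := farLayers_layer_le (d := 2) ht e1 ((H 3 le_rfl _ ht 1).2.1 3 (by norm_num)).2
    have b2 := farLayers_layer_le (d := 2) ht e2 ((H 3 le_rfl _ ht2 2).2.1 3 (by norm_num)).2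
    have b3 := farLayers_layer_le (d := 5) ht e2 ((H 6 (by norm_num) _ ht2 2).2.1 3 (by norm_num)).2
    refine ⟨b1.trans_eq ?_, b2.trans_eq ?_, b3.trans_eq ?_⟩
    · push_cast; ring
    · push_cast; ring
    · push_cast; ring
  have hk1 : ∀ k ∈ Finset.Ioc K (K + n), 1 ≤ k := fun k hk => by
    have := (Finset.mem_Ioc.1 hk).1; omega
  have h4 : ∑ k ∈ Finset.Ioc K (K + n), ((k : ℝ) ^ 4)⁻¹ ≤ 1 / (3 * (K : ℝ) ^ 3) := by
    simpa using farLayers_sum_inv_pow_le (m := 3) hK (by norm_num) n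
  have h6 : ∑ k ∈ Finset.Ioc K (K + n), ((k : ℝ) ^ 6)⁻¹ ≤ 1 / (5 * (K : ℝ) ^ 5) := by
    simpa using farLayers_sum_inv_pow_le (m := 5) hK (by norm_num) n
  have h10 : ∑ k ∈ Finset.Ioc K (K + n), ((k : ℝ) ^ 10)⁻¹ ≤ 1 / (9 * (K : ℝ) ^ 9) := by
    simpa using farLayers_sum_inv_pow_le (m := 9) hK (by norm_num) n
  have h12 : ∑ k ∈ Finset.Ioc K (K + n), ((k : ℝ) ^ 12)⁻¹ ≤ 1 / (11 * (K : ℝ) ^ 11) := by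
    simpa using farLayers_sum_inv_pow_le (m := 11) hK (by norm_num) n
  refine ⟨?_, ?_, ?_⟩
  · calc ∑ k ∈ Finset.Ioc K (K + n), layerSum 3 ((k : ℝ) * c) 1
        ≤ ∑ k ∈ Finset.Ioc K (K + n),
            (49 / c ^ 6 * ((k : ℝ) ^ 6)⁻¹ + 64 / (19 * c ^ 4) * ((k : ℝ) ^ 4)⁻¹) :=
          Finset.sum_le_sum fun k hk => (hpt k (hk1 k hk)).1
      _ = 49 / c ^ 6 * ∑ k ∈ Finset.Ioc K (K + n), ((k : ℝ) ^ 6)⁻¹ +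
            64 / (19 * c ^ 4) * ∑ k ∈ Finset.Ioc K (K + n), ((k : ℝ) ^ 4)⁻¹ := by
          rw [Finset.sum_add_distrib, Finset.mul_sum, Finset.mul_sum]
      _ ≤ 49 / c ^ 6 * (1 / (5 * (K : ℝ) ^ 5)) + 64 / (19 * c ^ 4) * (1 / (3 * (K : ℝ) ^ 3)) :=
          add_le_add (mul_le_mul_of_nonneg_left h6 (by positivity))
            (mul_le_mul_of_nonneg_left h4 (by positivity))
      _ = farTail3 K c := by unfold farTail3; ring
  · calc ∑ k ∈ Finset.Ioc K (K + n), layerSum 3 ((k : ℝ) * c / 2) 2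
        ≤ ∑ k ∈ Finset.Ioc K (K + n),
            (49 / c ^ 6 * ((k : ℝ) ^ 6)⁻¹ + 64 / (19 * c ^ 4) * ((k : ℝ) ^ 4)⁻¹) :=
          Finset.sum_le_sum fun k hk => (hpt k (hk1 k hk)).2.1
      _ = 49 / c ^ 6 * ∑ k ∈ Finset.Ioc K (K + n), ((k : ℝ) ^ 6)⁻¹ +
            64 / (19 * c ^ 4) * ∑ k ∈ Finset.Ioc K (K + n), ((k : ℝ) ^ 4)⁻¹ := by
          rw [Finset.sum_add_distrib, Finset.mul_sum, Finset.mul_sum]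
      _ ≤ 49 / c ^ 6 * (1 / (5 * (K : ℝ) ^ 5)) + 64 / (19 * c ^ 4) * (1 / (3 * (K : ℝ) ^ 3)) :=
          add_le_add (mul_le_mul_of_nonneg_left h6 (by positivity))
            (mul_le_mul_of_nonneg_left h4 (by positivity))
      _ = farTail3 K c := by unfold farTail3; ring
  · calc ∑ k ∈ Finset.Ioc K (K + n), layerSum 6 ((k : ℝ) * c / 2) 2
        ≤ ∑ k ∈ Finset.Ioc K (K + n),
            (49 / c ^ 12 * ((k : ℝ) ^ 12)⁻¹ + 128 / (95 * c ^ 10) * ((k : ℝ) ^ 10)⁻¹) :=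
          Finset.sum_le_sum fun k hk => (hpt k (hk1 k hk)).2.2
      _ = 49 / c ^ 12 * ∑ k ∈ Finset.Ioc K (K + n), ((k : ℝ) ^ 12)⁻¹ +
            128 / (95 * c ^ 10) * ∑ k ∈ Finset.Ioc K (K + n), ((k : ℝ) ^ 10)⁻¹ := by
          rw [Finset.sum_add_distrib, Finset.mul_sum, Finset.mul_sum]
      _ ≤ 49 / c ^ 12 * (1 / (11 * (K : ℝ) ^ 11)) + 128 / (95 * c ^ 10) * (1 / (9 * (K : ℝ) ^ 9)) :=
          add_le_add (mul_le_mul_of_nonneg_left h12 (by positivity))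
            (mul_le_mul_of_nonneg_left h10 (by positivity))
      _ = farTail6 K c := by unfold farTail6; ring

end Summit.AtomisticToContinuum.Crystallization.Theorems.SquareWellLayerCake.StackingFaultSparsity

end
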